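import Summits.AtomisticToContinuum.FouriersLaw.Theorems.OddSectorIrreversibilityTapLeakBoundFloorSupTail
import Summits.AtomisticToContinuum.FouriersLaw.Theorems.OddSectorIrreversibilityTapLeakBoundFloorLocalMoments
import Summits.AtomisticToContinuum.FouriersLaw.Theorems.OddSectorIrreversibilityTapLeakBoundFloorLogWindow

/-!
# `TapLeakBound` (stmt-AtomisticToContinuum-15159), line `SketchIdeator2`, third floor of `stub_kickCone`: the sup tail at a logarithmic cap

Helper file (`--supports stmt-AtomisticToContinuum-15159`) for crux P = `…Theses.OddSectorIrreversibility.TapLeakBound`,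
registered stub `stub_kickCone` (C′, linear window — open). Third floor program (lead c3, the LOG window): the Gibbs price of
capping the RUNNING MAXIMUM of a site energy at a level `E` that is only a `k`-th power, paid with moments of order `k`:

* `sup_tail_of_momentGrowth` / `stub_floorLogTail` — GIVEN quantitative single-coordinate moments
  `∫ q_i^{2m} dμ_T, ∫ p_i^{2m} dμ_T ≤ K^m (m!)² Z` for all `m` (`K ≥ 1`; the registered `stub_floorMomentGrowth`, taken here as a
  hypothesis), for every site `m`, every `k ≥ 1`, `s ≥ 0` and every cap `E ≥ 8Θ_k`, `Θ_k = 6(3 + ω₂ + lam + 6β) K² (2k)⁴`: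
  `μ_T{x : ∃ τ ∈ [0,s], E < h_m(Φ_τ x)} ≤ 12 (1 + s) 2^{-k} Z`, uniformly in `N`.
  Route: the landed sup-in-time maximal inequality (`measureReal_sup_gt_le_pow`, exponents `k` and `n = k − 1`), the weight
  bound `h^{k-1}(|j_{m-1}|+|j_m|) ≤ h^k + 2^{k-1}(|j_{m-1}|^k + |j_m|^k)` (`pow_mul_le_pow_succ_add`), the landed local moments with
  an explicit constant (`localMoments_core` at order `k`: `≤ (3+ω₂+lam+6β)^k 6^k (1 + 5 K^{2k}((2k)!)²) Z ≤ 6 Θ_k^k Z` by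
  `((2k)!)² ≤ (2k)^{4k}`), and `(2/E)^k · 6Θ_k^k · 2·2^k = 12 (4Θ_k/E)^k ≤ 12 · 2^{-k}`.

With `k = k(d) ≍ log d` (…FloorLogWindow) this is `≍ (1+d)^{-10}` at a cap `E ≍ (log d)⁴`, i.e. a box scale `R ≍ log d` and
the window `s ≲ d / log d`. References: folklore. Nothing here closes the item.
-/

noncomputable section

open MeasureTheory ProbabilityTheory Filter Topology Set Function
open scoped NNReal ENNReal

namespace Summit.AtomisticToContinuum.FouriersLaw.Theorems.OddSectorIrreversibility.TapLeak

open Literature.MathematicalPhysics.KineticTheory.HeatConduction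
open Literature.MathematicalPhysics.KineticTheory
open Summit.AtomisticToContinuum.FouriersLaw.Theorems.ClosedConeSensitivity.Negative.ZeroFrictionDictionary
open Summit.AtomisticToContinuum.FouriersLaw.Theorems.OddSectorIrreversibility.Corrector
open Summit.AtomisticToContinuum.FouriersLaw.Theorems.OddSectorWitness

/-! ### Two pointwise inequalities -/

/-- `a^n g ≤ a^{n+1} + g^{n+1}` for `a, g ≥ 0` (compare `g` with `a`). [folklore] -/
theorem pow_mul_le_pow_succ_add {a g : ℝ} (ha : 0 ≤ a) (hg : 0 ≤ g) (n : ℕ) :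
    a ^ n * g ≤ a ^ (n + 1) + g ^ (n + 1) := by
  have han : 0 ≤ a ^ n := pow_nonneg ha n
  have hgn : 0 ≤ g ^ (n + 1) := pow_nonneg hg _
  have ha1 : 0 ≤ a ^ (n + 1) := pow_nonneg ha _
  rcases le_or_gt g a with h | h
  · have : a ^ n * g ≤ a ^ n * a := mul_le_mul_of_nonneg_left h han
    rw [← pow_succ] at this
    linarith
  · have h1 : a ^ n ≤ g ^ n := pow_le_pow_left₀ ha h.le n
    have : a ^ n * g ≤ g ^ n * g := mul_le_mul_of_nonneg_right h1 hg
    rw [← pow_succ] at this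
    linarith

/-- `1 + 5C ≤ 6C` for `C ≥ 1`. [folklore] -/
theorem one_add_five_mul_le {C : ℝ} (hC : 1 ≤ C) : 1 + 5 * C ≤ 6 * C := by linarith

variable {N : ℕ}

section Pinned

variable {ω₂ lam β : ℝ} (hω : 0 < ω₂) (hl : 0 ≤ lam) (hβ : 0 ≤ β) (γ : ℝ) {T : ℝ} (hT : 0 < T)
include hω hl hβ hT

set_option maxHeartbeats 1000000 in
-- a long bookkeeping proof with many local definitions; the default budget is marginal
/-- **THE SUP TAIL AT A `k`-TH POWER CAP, uniformly in `N`.** Given the quantitative single-coordinate Gibbs moments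
`∫ q_i^{2m}, ∫ p_i^{2m} ≤ K^m (m!)² Z` (all `m, N, i`; `K ≥ 1`), for every site `m`, `k ≥ 1`, `s ≥ 0` and every cap
`E ≥ 8 Θ`, `Θ = 6(3 + ω₂ + lam + 6β) K² (2k)⁴`:
`μ_T{x : ∃ τ ∈ [0,s], E < h_m(Φ_τ x)} ≤ 12 (1 + s) (1/2)^k Z`. [folklore] -/
theorem sup_tail_of_momentGrowth {K : ℝ} (hK1 : 1 ≤ K)
    (hKm : ∀ (m N : ℕ) (i : Fin N), ∫ x, (x.1 i) ^ (2 * m) ∂(gibbsWeight ω₂ lam β γ N T) ≤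
        K ^ m * ((m.factorial : ℝ)) ^ 2 * ∫ x, Real.exp (-((pinnedChain ω₂ lam β γ).hamiltonian N x) / T) ∂volume ∧
      ∫ x, (x.2 i) ^ (2 * m) ∂(gibbsWeight ω₂ lam β γ N T) ≤
        K ^ m * ((m.factorial : ℝ)) ^ 2 * ∫ x, Real.exp (-((pinnedChain ω₂ lam β γ).hamiltonian N x) / T) ∂volume)
    (m : Fin N) (X : PhaseSpace N → ℝ)
    (hX : X = fun x => (∑ k : Fin N, (if k = m then (1 : ℝ) else 0) * (x.2 k ^ 2 / 2 + (pinnedChain ω₂ lam β 0).U (x.1 k))) +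
      ∑ k : Fin N, ∑ l : Fin N,
        if l.val = k.val + 1 then ((if k = m then (1 : ℝ) else 0) + (if l = m then (1 : ℝ) else 0)) / 2 *
          (pinnedChain ω₂ lam β 0).V (x.1 l - x.1 k) else 0)
    {k : ℕ} (hk : 1 ≤ k) {s E : ℝ} (hs : 0 ≤ s)
    (hE : 8 * (6 * (3 + ω₂ + lam + 6 * β) * K ^ 2 * (((2 * k : ℕ) : ℝ)) ^ 4) ≤ E) :
    (gibbsWeight ω₂ lam β γ N T).real {x | ∃ τ ∈ Icc (0 : ℝ) s, E < X (detFlow ω₂ lam β N τ x)} ≤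
      12 * (1 + s) * (1 / 2 : ℝ) ^ k * ∫ x, Real.exp (-((pinnedChain ω₂ lam β γ).hamiltonian N x) / T) ∂volume := by
  obtain ⟨n, rfl⟩ : ∃ n, k = n + 1 := ⟨k - 1, by omega⟩
  set μ := gibbsWeight ω₂ lam β γ N T with hμ
  haveI : IsFiniteMeasure μ := isFiniteMeasure_gibbsWeight hω hl hβ γ N hT
  set P0 := pinnedChain ω₂ lam β 0 with hP0
  set Z : ℝ := ∫ x, Real.exp (-((pinnedChain ω₂ lam β γ).hamiltonian N x) / T) ∂volume with hZ
  have hZ0 : 0 ≤ Z := integral_nonneg fun x => (Real.exp_pos _).le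
  set c₀ : ℝ := 3 + ω₂ + lam + 6 * β with hc₀
  have hc₀0 : 0 ≤ c₀ := by positivity
  set kk : ℝ := ((2 * (n + 1) : ℕ) : ℝ) with hkk
  have hkk0 : 0 ≤ kk := Nat.cast_nonneg _
  set Θ : ℝ := 6 * c₀ * K ^ 2 * kk ^ 4 with hΘ
  have hΘ0 : 0 ≤ Θ := by positivity
  have hK0 : 0 < K := by linarith
  have hkk1 : (1 : ℝ) ≤ kk := by
    rw [hkk]; exact_mod_cast (show 1 ≤ 2 * (n + 1) by omega)
  have hkkpos : 0 < kk := by linarith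
  have hc₀pos : 0 < c₀ := by rw [hc₀]; linarith
  have hΘpos : 0 < Θ := by positivity
  have hEpos : 0 < E := by linarith
  -- the explicit moment constant at order `k = n + 1`
  set C : ℝ := K ^ (2 * (n + 1)) * ((Nat.factorial (2 * (n + 1)) : ℕ) : ℝ) ^ 2 with hC
  have hC1 : 1 ≤ C := by
    have h1 : 1 ≤ K ^ (2 * (n + 1)) := one_le_pow₀ hK1
    have h2 : (1 : ℝ) ≤ ((Nat.factorial (2 * (n + 1)) : ℕ) : ℝ) ^ 2 :=
      one_le_pow₀ (by exact_mod_cast Nat.succ_le_of_lt (Nat.factorial_pos _))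
    exact one_le_mul_of_one_le_of_one_le h1 h2
  have hq : ∀ i : Fin N, ∫ x, (x.1 i) ^ (2 * (2 * (n + 1))) ∂μ ≤ C * Z := fun i => by
    have h := (hKm (2 * (n + 1)) N i).1
    simpa only [hC, Nat.cast_id] using h
  have hp : ∀ i : Fin N, ∫ x, (x.2 i) ^ (2 * (2 * (n + 1))) ∂μ ≤ C * Z := fun i => by
    have h := (hKm (2 * (n + 1)) N i).2
    simpa only [hC, Nat.cast_id] using h
  set B : ℝ := c₀ ^ (n + 1) * (6 ^ (n + 1) * (1 + 5 * C)) with hB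
  have hB0 : 0 ≤ B := by positivity
  -- `B ≤ 6 Θ^k`
  have hBΘ : B ≤ 6 * Θ ^ (n + 1) := by
    have hfac : ((Nat.factorial (2 * (n + 1)) : ℕ) : ℝ) ^ 2 ≤ kk ^ (4 * (n + 1)) := factorial_two_mul_sq_le (n + 1)
    have h15 : 1 + 5 * C ≤ 6 * C := one_add_five_mul_le hC1
    have hC' : C ≤ K ^ (2 * (n + 1)) * kk ^ (4 * (n + 1)) := mul_le_mul_of_nonneg_left hfac (by positivity)
    calc B = c₀ ^ (n + 1) * 6 ^ (n + 1) * (1 + 5 * C) := by rw [hB]; ring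
      _ ≤ c₀ ^ (n + 1) * 6 ^ (n + 1) * (6 * C) := mul_le_mul_of_nonneg_left h15 (by positivity)
      _ ≤ c₀ ^ (n + 1) * 6 ^ (n + 1) * (6 * (K ^ (2 * (n + 1)) * kk ^ (4 * (n + 1)))) := by gcongr
      _ = 6 * Θ ^ (n + 1) := by
          rw [hΘ, show K ^ (2 * (n + 1)) = (K ^ 2) ^ (n + 1) by rw [← pow_mul],
            show kk ^ (4 * (n + 1)) = (kk ^ 4) ^ (n + 1) by rw [← pow_mul]]
          ring
  -- local moments of order `k` at the site and its left neighbour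
  obtain ⟨⟨hXk_i, hXk⟩, hjR_i, hjR⟩ := localMoments_core hω hl hβ γ hT (n + 1) hq hp m X hX
  set jL : PhaseSpace N → ℝ := fun z =>
    ∑ k : Fin N, if k.val + 1 = m.val then P0.bondCurrent N k z else 0 with hjL
  set jR : PhaseSpace N → ℝ := fun z => P0.bondCurrent N m z with hjR'
  have hjRb : Integrable (fun x => |jR x| ^ (n + 1)) μ ∧ ∫ x, |jR x| ^ (n + 1) ∂μ ≤ B * Z := ⟨hjR_i, hjR⟩
  have hjLb : Integrable (fun x => |jL x| ^ (n + 1)) μ ∧ ∫ x, |jL x| ^ (n + 1) ∂μ ≤ B * Z := by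
    by_cases hm0 : m.val = 0
    · have e : jL = fun _ => 0 := funext fun z => leftCurrent_eq_zero P0 hm0 z
      rw [e]
      simp only [abs_zero, ne_eq, Nat.succ_ne_zero, not_false_eq_true, zero_pow, integral_zero]
      exact ⟨integrable_const _, mul_nonneg hB0 hZ0⟩
    · set im : Fin N := ⟨m.val - 1, by omega⟩ with him'
      have him : m.val = im.val + 1 := by simp [him']; omega
      have e : jL = fun z => P0.bondCurrent N im z := funext fun z => leftCurrent_eq_of_succ P0 him z
      rw [e]
      exact (localMoments_core hω hl hβ γ hT (n + 1) hq hp im _ rfl).2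
  -- the weight of the maximal inequality
  have hU0 : ∀ q, 0 ≤ P0.U q := fun q => by
    show 0 ≤ ω₂ * q ^ 2 / 2 + lam * q ^ 4 / 4; positivity
  have hV0 : ∀ r, 0 ≤ P0.V r := fun r => by
    show 0 ≤ r ^ 2 / 2 + β * r ^ 4 / 4; positivity
  have hX0 : ∀ x, 0 ≤ X x := fun x => siteEnergy_nonneg P0 m X hX hU0 hV0 x
  have hXc : Continuous X := (contDiff_siteEnergy m X hX).continuous
  have hjLc : Continuous jL := continuous_leftCurrent ω₂ lam β 0 N m
  have hjRc : Continuous jR := pinnedChain_continuous_bondCurrent ω₂ lam β 0 N m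
  set W : PhaseSpace N → ℝ := fun x => X x ^ n * (|jL x| + |jR x|) with hW
  have hWc : Continuous W := (hXc.pow n).mul (hjLc.abs.add hjRc.abs)
  have hW0 : ∀ x, 0 ≤ W x := fun x => mul_nonneg (pow_nonneg (hX0 x) n) (add_nonneg (abs_nonneg _) (abs_nonneg _))
  have hWle : ∀ x, W x ≤ X x ^ (n + 1) + 2 ^ n * (|jL x| ^ (n + 1) + |jR x| ^ (n + 1)) := fun x =>
    (pow_mul_le_pow_succ_add (hX0 x) (add_nonneg (abs_nonneg _) (abs_nonneg _)) n).trans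
      (add_le_add le_rfl (add_pow_succ_le_two_pow_mul (abs_nonneg (jL x)) (abs_nonneg (jR x)) n))
  have hJi : Integrable (fun x => |jL x| ^ (n + 1) + |jR x| ^ (n + 1)) μ := hjLb.1.add hjRb.1
  have hDom : Integrable (fun x => X x ^ (n + 1) + 2 ^ n * (|jL x| ^ (n + 1) + |jR x| ^ (n + 1))) μ :=
    hXk_i.add (hJi.const_mul _)
  have hWi : Integrable W μ := by
    refine hDom.mono' hWc.aestronglyMeasurable (Eventually.of_forall fun x => ?_)
    rw [Real.norm_of_nonneg (hW0 x)]
    exact hWle x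
  have hWint : ∫ x, W x ∂μ ≤ (1 + 2 ^ (n + 1)) * B * Z := by
    calc ∫ x, W x ∂μ ≤ ∫ x, (X x ^ (n + 1) + 2 ^ n * (|jL x| ^ (n + 1) + |jR x| ^ (n + 1))) ∂μ :=
          integral_mono hWi hDom hWle
      _ = (∫ x, X x ^ (n + 1) ∂μ) + 2 ^ n * ((∫ x, |jL x| ^ (n + 1) ∂μ) + ∫ x, |jR x| ^ (n + 1) ∂μ) := by
          rw [integral_add hXk_i (hJi.const_mul _), integral_const_mul, integral_add hjLb.1 hjRb.1]
      _ ≤ B * Z + 2 ^ n * (B * Z + B * Z) := by gcongr <;> first | exact hXk | exact hjLb.2 | exact hjRb.2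
      _ = (1 + 2 ^ (n + 1)) * B * Z := by ring
  -- the maximal inequality with exponents `k = n + 1` and `n`
  have hmax := measureReal_sup_gt_le_pow hω hl hβ γ hT m X hX (k := n + 1) (n := n) hXk_i hWi hs hEpos
  refine hmax.trans ?_
  have h2E : (0 : ℝ) ≤ 2 / E := by positivity
  have hratio : (2 / E) * (2 * Θ) ≤ 1 / 2 := by
    rw [div_mul_eq_mul_div, div_le_iff₀ hEpos]; linarith
  have hratio0 : 0 ≤ (2 / E) * (2 * Θ) := by positivity
  have hpow : ((2 / E) * (2 * Θ)) ^ (n + 1) ≤ (1 / 2 : ℝ) ^ (n + 1) := pow_le_pow_left₀ hratio0 hratio _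
  have hs1 : 0 ≤ 1 + s := by linarith
  -- both terms against `(2/E)^k · (1 + 2^k) B Z (1 + s)`
  have hT1 : (2 / E) ^ (n + 1) * ∫ x, X x ^ (n + 1) ∂μ ≤ (2 / E) ^ (n + 1) * (B * Z) :=
    mul_le_mul_of_nonneg_left hXk (pow_nonneg h2E _)
  have hT2 : (2 / E) ^ (n + 1) * s * ∫ x, W x ∂μ ≤ (2 / E) ^ (n + 1) * s * ((1 + 2 ^ (n + 1)) * B * Z) :=
    mul_le_mul_of_nonneg_left hWint (by positivity)
  have hsum : (2 / E) ^ (n + 1) * (B * Z) + (2 / E) ^ (n + 1) * s * ((1 + 2 ^ (n + 1)) * B * Z) ≤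
      (2 / E) ^ (n + 1) * ((2 * 2 ^ (n + 1)) * B) * (1 + s) * Z := by
    have hq0 : 0 ≤ (2 / E) ^ (n + 1) := pow_nonneg h2E _
    have e : (2 / E) ^ (n + 1) * ((2 * 2 ^ (n + 1)) * B) * (1 + s) * Z -
        ((2 / E) ^ (n + 1) * (B * Z) + (2 / E) ^ (n + 1) * s * ((1 + 2 ^ (n + 1)) * B * Z)) =
        (2 / E) ^ (n + 1) * B * Z * ((2 * 2 ^ (n + 1) - 1) + s * (2 * 2 ^ (n + 1) - (1 + 2 ^ (n + 1)))) := by ring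
    have h21 : (1 : ℝ) ≤ 2 ^ (n + 1) := one_le_pow₀ (by norm_num)
    have hin1 : (0 : ℝ) ≤ 2 * 2 ^ (n + 1) - (1 + 2 ^ (n + 1)) := by linarith
    have hin2 : (0 : ℝ) ≤ 2 * 2 ^ (n + 1) - 1 := by linarith
    have hin : 0 ≤ (2 * 2 ^ (n + 1) - 1) + s * (2 * 2 ^ (n + 1) - (1 + (2 : ℝ) ^ (n + 1))) :=
      add_nonneg hin2 (mul_nonneg hs hin1)
    rw [← sub_nonneg, e]
    exact mul_nonneg (mul_nonneg (mul_nonneg hq0 hB0) hZ0) hin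
  have e3 : ((2 / E) * (2 * Θ)) ^ (n + 1) = (2 / E) ^ (n + 1) * (2 ^ (n + 1) * Θ ^ (n + 1)) := by
    rw [mul_pow (2 / E) (2 * Θ) (n + 1), mul_pow (2 : ℝ) Θ (n + 1)]
  have hfin : (2 / E) ^ (n + 1) * ((2 * 2 ^ (n + 1)) * B) ≤ 12 * (1 / 2 : ℝ) ^ (n + 1) := by
    calc (2 / E) ^ (n + 1) * ((2 * 2 ^ (n + 1)) * B) ≤ (2 / E) ^ (n + 1) * ((2 * 2 ^ (n + 1)) * (6 * Θ ^ (n + 1))) := by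
          gcongr
      _ = 12 * ((2 / E) * (2 * Θ)) ^ (n + 1) := by
          rw [e3]; ring
      _ ≤ 12 * (1 / 2 : ℝ) ^ (n + 1) := by gcongr
  calc (2 / E) ^ (n + 1) * ∫ x, X x ^ (n + 1) ∂μ + (2 / E) ^ (n + 1) * s * ∫ x, W x ∂μ
      ≤ (2 / E) ^ (n + 1) * (B * Z) + (2 / E) ^ (n + 1) * s * ((1 + 2 ^ (n + 1)) * B * Z) := add_le_add hT1 hT2
    _ ≤ (2 / E) ^ (n + 1) * ((2 * 2 ^ (n + 1)) * B) * (1 + s) * Z := hsum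
    _ ≤ 12 * (1 / 2 : ℝ) ^ (n + 1) * (1 + s) * Z := by gcongr
    _ = 12 * (1 + s) * (1 / 2 : ℝ) ^ (n + 1) * Z := by ring

end Pinned

/-! ### Registered sub-goal of the line (closed form of `sup_tail_of_momentGrowth`) -/

/-- **Sub-goal `stub_floorLogTail`** (registered on the crux item for this helper file; closed `∀`-form of
`sup_tail_of_momentGrowth`): the `N`-uniform sup tail of a site energy at a `k`-th power cap, from quantitative moments. [folklore] -/
theorem stub_floorLogTail : ∀ (ω₂ lam β : ℝ), 0 < ω₂ → 0 ≤ lam → 0 ≤ β → ∀ (γ : ℝ) (T : ℝ), 0 < T → ∀ (K : ℝ), 1 ≤ K → (∀ (m N : ℕ) (i : Fin N), ∫ x, (x.1 i) ^ (2 * m) ∂(gibbsWeight ω₂ lam β γ N T) ≤ K ^ m * ((m.factorial : ℝ)) ^ 2 * ∫ x, Real.exp (-((pinnedChain ω₂ lam β γ).hamiltonian N x) / T) ∂MeasureTheory.volume ∧ ∫ x, (x.2 i) ^ (2 * m) ∂(gibbsWeight ω₂ lam β γ N T) ≤ K ^ m * ((m.factorial : ℝ)) ^ 2 * ∫ x,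 Real.exp (-((pinnedChain ω₂ lam β γ).hamiltonian N x) / T) ∂MeasureTheory.volume) → ∀ (N : ℕ) (m : Fin N) (X : PhaseSpace N → ℝ), (X = fun x => (∑ k : Fin N, (if k = m then (1 : ℝ) else 0) * (x.2 k ^ 2 / 2 + (pinnedChain ω₂ lam β 0).U (x.1 k))) + ∑ k : Fin N, ∑ l : Fin N, if l.val = k.val + 1 then ((if k = m then (1 : ℝ) else 0) + (if l = m then (1 : ℝ) else 0)) / 2 * (pinnedChain ω₂ lam β 0).V (x.1 l - x.1 k) else 0) → ∀ (k : ℕ), 1 ≤ k → ∀ (s E : ℝ), 0 ≤ s → 8 * (6 * (3 + ω₂ + lam + 6 * β) * K ^ 2 * (((2 * k : ℕ) : ℝ)) ^ 4) ≤ E → (gibbsWeight ω₂ lam β γ N T).real {x | ∃ τ ∈ Set.Icc (0 : ℝ) s, E < X (Summit.AtomisticToContinuum.FouriersLaw.Theorems.ClosedConeSensitivity.Negative.ZeroFrictionDictionary.detFlow ω₂ lam β N τ x)} ≤ 12 * (1 + s) * (1 / 2 : ℝ) ^ k * ∫ x, Real.exp (-((pinnedChain ω₂ lam β γ).hamiltonian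 N x) / T) ∂MeasureTheory.volume :=
  fun _ _ _ hω hl hβ γ _ hT _ hK1 hKm _ m X hX _ hk _ _ hs hE =>
    sup_tail_of_momentGrowth hω hl hβ γ hT hK1 hKm m X hX hk hs hE

end Summit.AtomisticToContinuum.FouriersLaw.Theorems.OddSectorIrreversibility.TapLeak

end
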